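import Literature.AnabelianGeometry.EtaleTheta.Discharge.Sec5Thm56OfBiKummerDataAllLeaves
import Literature.AnabelianGeometry.EtaleTheta.Discharge.Sec5ThetaSectionCompatOfKummerClass

/-!
# [EtTh] Prop. 5.5 ⊕ Thm. 5.6 (i) at the GENUINE §5 data — consolidation v3, PIN variant: «Prop. 5.2 (iii) enters ONCE»

Mochizuki, *The étale theta function and its Frobenioid-theoretic manifestations*, Publ. RIMS **45** (2009)
[cite: MochizukiEtTh2009, Prop 5.5 p.327 (PDF p.101); Thm 5.6 p.328 (PDF p.102)].  abc-iut cell, layer L2, row K4 «SUBDAG-Thm56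
CONSOLIDATION v3» (seat abc-iut-w5-d034, custodian; abc-iut-L2-lead 08:09:20Z: «w5-d034 folds the same substitution into
AllLeavesV3»).  PROOF-ONLY (no definition, no new named fact).  Companion of `Sec5Thm56OfBiKummerDataAllLeavesV3.lean`
(p431672: one-binder Ψ-transport `hpsi`, γ-package `hΓ`, dictionary variant for `hKR`); this file gives the PIN variant:

* `ThetaFrobenioid.exists_rigidityFamily_unique_preserved_ofBiKummerData_of_leaves_model_of_pin` — abc-iut-w5-d020's v2 knit
  (p428546) with the Ψ-transport consolidated into `hpsi`, the Galois shadow through `hΓ`, and the Galois-equivariance of the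
  bi-Kummer root `hKR` (GAP G-L6t23-3) DERIVED by abc-iut-w4-d099's `hKR_ofBiKummerData_of_pin` from the (η₀, ν) PIN of
  Prop. 5.2 (iii) that the knit ALREADY carries (`hη₀`, `hdies`, `e`, `ν`, `hKν`) together with the §5 `Facts`, the cyclotome
  dictionary `m` with `m ∘ ν ∘ e = id`, the cyclotomic-character compatibility (F-1306) and coverage at `H_{B_N}` — so that
  Prop. 5.2 (iii) enters the (C2) hypothesis list ONCE (no separate theta-section-compatibility binder).
Residual binders: v2's list MINUS {θA, hθ, ΨN, hdeg, hbi, hft, hKR} PLUS {hpsi, H, m, hme, hχX, hcovHB}; γ-package as `hΓ`.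
HONEST FRAMING: kernel-checked implications between typed statements about the assembled §5 data; nothing asserts that such data
exist for an actual curve; typed ≠ discharged; no side taken on [IUTchIII] Cor. 3.12.
-/

noncomputable section

namespace Literature.AnabelianGeometry.EtaleTheta

open CategoryTheory Opposite FrobenioidCyclotomicRigidity Literature.AlgebraicGeometry.Frobenioids

universe u₀ v₀ u v w v₁ u₁

namespace ThetaFrobenioid

section Data


variable {K : Type u₀} [Field K]
  {X : SemiGraphs.TemperedArithmeticGroup.{u₀} K} {D₀ : Type u₀} [Category.{v₀} D₀]
  {V : FrdIMonoidStub.{w}} {T₀ : RealifiedDivisorMonoids (D₀ := D₀) V} {D : Type u} [Category.{v} D]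
  {VD : FrdICatStub.{u, v, w} D} {S : BiKummerSetting X T₀ D VD}
  {pullFrac : ∀ {A A' : S.C} (_ : A' ⟶ A), S.biratUnits A → S.biratUnits A'}
  {lv N : ℕ+} {l' : ℕ} {RD : RigidData.{max v w} N l'} {θ : S.biratUnits S.Aodot} {Bl : S.C}
  {Pl : S.FractionPair θ Bl} {Rl : S.NthRoot θ Pl lv pullFrac}
  (h : ModelFrobenioid.Hypotheses S.tf.divisorMonoid S.tf.ratFnFunctor)
  (toB : ∀ A : S.C, S.biratUnits A →* S.tf.biratUnitsModel A) (Q : FrobenioidTheta.ThetaSubquotientStub.{w} D)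
  (odd_l : Odd (lv : ℕ)) (R : S.NthRoot Rl.root Rl.pair N pullFrac) (ιX : RD.PiX ≃ₜ* X.Pi)
  (hopen : IsOpen ((S.galoisSurj R.AN.base R.αData.isGalois).ker : Set X.Pi)) (σ : Aut R.AN.base →* Aut R.AN)
  (K' : Type w) [Field K'] (constEmb : K'ˣ →* S.tf.biratUnitsModel R.BN)
  (constEmb_injective : Function.Injective constEmb)
  (hdivc : ∀ g : Aut R.BN.base,
    ModelFrobenioid.div ((σ ((BiKummerSetting.NthRoot.baseIso S R).conjAut.symm g)).hom ≫ R.pair.num) =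
      ModelFrobenioid.div R.pair.num)
  (hdivp : ∀ y : RD.PiYdd,
    ModelFrobenioid.div ((σ (S.galoisSurj R.AN.base R.αData.isGalois (ιX y.1))).hom ≫ R.pair.den) =
      ModelFrobenioid.div R.pair.den)

/-- **[EtTh] Prop. 5.5 ⊕ Thm. 5.6 (i) AT THE GENUINE §5 DATA, PIN variant** — `hKR` derived from the (η₀, ν) pin of Prop. 5.2 (iii)
(abc-iut-w4-d099 `hKR_ofBiKummerData_of_pin`), Ψ-transport at `A_N` as the one existential binder `hpsi`, Galois shadow through
`hΓ`; every other leaf as in abc-iut-w5-d020's v2 knit.  [cite: MochizukiEtTh2009, Thm 5.6 p.328 (PDF p.102)] -/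
theorem exists_rigidityFamily_unique_preserved_ofBiKummerData_of_leaves_model_of_pin
    -- Prop 5.5 side (η / ν pin, reachability, stub laws)
    (hB : (ofBiKummerData h toB Q odd_l R ιX hopen σ K' constEmb constEmb_injective hdivc hdivp).IsThetaSaturated (ofBiKummerData h toB Q odd_l R ιX hopen σ K' constEmb constEmb_injective hdivc hdivp).BN) (P : ThetaSubquotientProj (ofBiKummerData h toB Q odd_l R ιX hopen σ K' constEmb constEmb_injective hdivc hdivp))
    {η₀ : RD.PiYdd → RD.mu} (hη₀ : η₀ ∈ RD.thetaCocycles)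
    (hdies : ∀ k : RD.PiYdd, rhoOfBiKummerData R ιX k = 1 → η₀ k = 1)
    (e : RD.mu → (ofBiKummerData h toB Q odd_l R ιX hopen σ K' constEmb constEmb_injective hdivc hdivp).lDeltaModN (ofBiKummerData h toB Q odd_l R ιX hopen σ K' constEmb constEmb_injective hdivc hdivp).BN) (he : Function.Surjective e)
    (hpre : ∀ k : RD.PiYdd, (k : RD.PiX) ∈ RD.lDeltaTheta → rhoOfBiKummerData R ιX k ∈ P.pre _)
    (hP : ∀ (k : RD.PiYdd) (hk : (k : RD.PiX) ∈ RD.lDeltaTheta) (hm : rhoOfBiKummerData R ιX k ∈ P.pre _),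
      (QuotientGroup.mk (P.proj _ ⟨rhoOfBiKummerData R ιX k, hm⟩) : (ofBiKummerData h toB Q odd_l R ιX hopen σ K' constEmb constEmb_injective hdivc hdivp).lDeltaModN (ofBiKummerData h toB Q odd_l R ιX hopen σ K' constEmb constEmb_injective hdivc hdivp).BN) = e (RD.thetaMod ⟨k, hk⟩))
    (hcov' : ∀ g ∈ P.pre ((ofBiKummerData h toB Q odd_l R ιX hopen σ K' constEmb constEmb_injective hdivc hdivp).base.obj (ofBiKummerData h toB Q odd_l R ιX hopen σ K' constEmb constEmb_injective hdivc hdivp).BN), ∃ k : RD.PiYdd, (k : RD.PiX) ∈ RD.lDeltaTheta ∧ rhoOfBiKummerData R ιX k = g)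
    (ν : (ofBiKummerData h toB Q odd_l R ιX hopen σ K' constEmb constEmb_injective hdivc hdivp).lDeltaModN (ofBiKummerData h toB Q odd_l R ιX hopen σ K' constEmb constEmb_injective hdivc hdivp).BN ≃* (ofBiKummerData h toB Q odd_l R ιX hopen σ K' constEmb constEmb_injective hdivc hdivp).muTorsion (ofBiKummerData h toB Q odd_l R ιX hopen σ K' constEmb constEmb_injective hdivc hdivp).BN (ofBiKummerData h toB Q odd_l R ιX hopen σ K' constEmb constEmb_injective hdivc hdivp).N)
    (hKν : ∀ η : (ofBiKummerData h toB Q odd_l R ιX hopen σ K' constEmb constEmb_injective hdivc hdivp).HB → (ofBiKummerData h toB Q odd_l R ιX hopen σ K' constEmb constEmb_injective hdivc hdivp).lDeltaModN (ofBiKummerData h toB Q odd_l R ιX hopen σ K' constEmb constEmb_injective hdivc hdivp).BN,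
      (∀ k : RD.PiYdd, η ⟨rhoOfBiKummerData R ιX k, Subgroup.mem_map_of_mem _ k.2⟩ = e (η₀ k)) →
        FrobenioidThetaBiKummer.ThetaPairKummerClass (ofBiKummerData h toB Q odd_l R ιX hopen σ K' constEmb constEmb_injective hdivc hdivp) η ν)
    (hσ : ∀ g : Aut R.AN.base, ModelFrobenioid.baseMap (σ g).hom = g.hom)
    (hgeom : P.pre R.BN.base ≤ RD.aug.ker.map (rhoOfBiKummerData R ιX))
    -- T56-L09b: Prop 3.4 (ii) constants + the origin clause «cnst kills Ker aug» (G-w5d020-2)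
    {Dcnst : Type u₁} [Category.{v₁} Dcnst] {cnst : D₀ ⥤ Dcnst} (hP34 : RealifiedDivisorMonoids.Prop34Cnst T₀ cnst)
    (hΔcnst : ∀ δ ∈ RD.aug.ker,
      cnst.map (S.tf.base.map (rhoOfBiKummerData R ιX δ).hom) = 𝟙 (cnst.obj (S.tf.base.obj R.BN.base)))
    (hreach : LinearlyReachableFromBN (ofBiKummerData h toB Q odd_l R ιX hopen σ K' constEmb constEmb_injective hdivc hdivp))
    (hLc : Thm56Sub.LDeltaMapComp (ofBiKummerData h toB Q odd_l R ιX hopen σ K' constEmb constEmb_injective hdivc hdivp)) (hLi : Thm56Sub.LDeltaMapId (ofBiKummerData h toB Q odd_l R ιX hopen σ K' constEmb constEmb_injective hdivc hdivp))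
    -- P55-L06 leaves: (G) as the base law, hproj named, hcup as the pull-root law of abc-iut-L6-t23
    (hGalT : ∀ ⦃A : D⦄, S.IsGaloisObj A → ∀ ⦃T : D⦄ (b b' : A ⟶ T), ∃ g : Aut A, b' = g.hom ≫ b)
    (hproj : ∀ (g g' : Aut ((ofBiKummerData h toB Q odd_l R ιX hopen σ K' constEmb constEmb_injective hdivc hdivp).base.obj (ofBiKummerData h toB Q odd_l R ιX hopen σ K' constEmb constEmb_injective hdivc hdivp).BN)) (hh : g' ∈ P.pre _), ∃ hgh : g * g' * g⁻¹ ∈ P.pre _,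
      (ofBiKummerData h toB Q odd_l R ιX hopen σ K' constEmb constEmb_injective hdivc hdivp).lDeltaMap g.hom (P.proj _ ⟨g', hh⟩) = P.proj _ ⟨g * g' * g⁻¹, hgh⟩)
    -- hKR (G-L6t23-3) by abc-iut-w4-d099's PIN route (p-file Sec5ThetaSectionCompatOfKummerClass): «Prop 5.2 (iii) enters ONCE» —
    -- the (η₀, ν) pin above + Facts + the cyclotome dictionary m with m ∘ ν ∘ e = id + cyclotomic-character compatibility (F-1306)
    (H : (ofBiKummerData h toB Q odd_l R ιX hopen σ K' constEmb constEmb_injective hdivc hdivp).Facts)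
    (m : (ofBiKummerData h toB Q odd_l R ιX hopen σ K' constEmb constEmb_injective hdivc hdivp).muTorsion (ofBiKummerData h toB Q odd_l R ιX hopen σ K' constEmb constEmb_injective hdivc hdivp).BN (ofBiKummerData h toB Q odd_l R ιX hopen σ K' constEmb constEmb_injective hdivc hdivp).N ≃* RD.mu)
    (hme : ∀ x : RD.mu, m (ν (e x)) = x)
    (hχX : (ofBiKummerData h toB Q odd_l R ιX hopen σ K' constEmb constEmb_injective hdivc hdivp).CyclotomicCharacterCompatX RD.toThetaEnvData (MulEquiv.refl _) m)
    (hcovHB : ∀ k : (ofBiKummerData h toB Q odd_l R ιX hopen σ K' constEmb constEmb_injective hdivc hdivp).HB, (k : Aut ((ofBiKummerData h toB Q odd_l R ιX hopen σ K' constEmb constEmb_injective hdivc hdivp).base.obj (ofBiKummerData h toB Q odd_l R ιX hopen σ K' constEmb constEmb_injective hdivc hdivp).BN)) ∈ P.pre _ →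
      ∃ (y : RD.PiX) (_ : y ∈ RD.PiYdd), (ofBiKummerData h toB Q odd_l R ιX hopen σ K' constEmb constEmb_injective hdivc hdivp).ρ y = k ∧ y ∈ RD.lDeltaTheta)
    -- t4's inputs discharging hdiff ([FrdI] Prop 5.6 section law, Π^tp_Ÿ ⊆ H_⊙, Thm 5.2 (ii) dictionary)
    (hH : ∀ y : RD.PiX, y ∈ RD.PiYdd → ιX y ∈ S.Hodot)
    (hfrac : ∀ {A B : S.C} (s' s'' : A ⟶ B) (h' : S.IsPreStep s') (h'' : S.IsPreStep s'')
      (hb : PreFrobenioid.BaseEquivalent S.F s' s''),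
      (toB A (S.fracOf s' s'' h' h'' hb) : S.tf.ratFnFunctor.obj (op A.base)) *
        ModelFrobenioid.unit s'' = ModelFrobenioid.unit s')
    (haut : ∀ {A : S.C} (e : Aut A) (x : S.biratUnits A),
      (toB A (S.biratAut A e x) : S.tf.ratFnFunctor.obj (op A.base)) =
        pull S.tf.ratFnFunctor (ModelFrobenioid.baseMap e.inv) (toB A x : S.tf.ratFnFunctor.obj (op A.base)))
    -- Thm 5.6 side: Ψ, its base shadow, Δ-transport and μ-pull data (abc-iut-L2-d4)
    (Ψ : S.C ≌ S.C) (Ψbs : D ⥤ D) [Ψbs.Faithful] (eΨ : Ψ.functor ⋙ (ofBiKummerData h toB Q odd_l R ιX hopen σ K' constEmb constEmb_injective hdivc hdivp).base ≅ (ofBiKummerData h toB Q odd_l R ιX hopen σ K' constEmb constEmb_injective hdivc hdivp).base ⋙ Ψbs)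
    (aΨ : ∀ A : S.C, (ofBiKummerData h toB Q odd_l R ιX hopen σ K' constEmb constEmb_injective hdivc hdivp).lDeltaModN A ≃* (ofBiKummerData h toB Q odd_l R ιX hopen σ K' constEmb constEmb_injective hdivc hdivp).lDeltaModN (Ψ.functor.obj A))
    (hlin : PreFrobenioidData.PreservesMor Ψ.functor (ofBiKummerData h toB Q odd_l R ιX hopen σ K' constEmb constEmb_injective hdivc hdivp).IsLinear (ofBiKummerData h toB Q odd_l R ιX hopen σ K' constEmb constEmb_injective hdivc hdivp).IsLinear)
    (haΨn : ∀ {A A' : S.C} (φ : A ⟶ A') (x : (ofBiKummerData h toB Q odd_l R ιX hopen σ K' constEmb constEmb_injective hdivc hdivp).lDeltaModN A),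
      aΨ A' ((ofBiKummerData h toB Q odd_l R ιX hopen σ K' constEmb constEmb_injective hdivc hdivp).lDeltaModNMap φ x) = (ofBiKummerData h toB Q odd_l R ιX hopen σ K' constEmb constEmb_injective hdivc hdivp).lDeltaModNMap (Ψ.functor.map φ) (aΨ A x))
    (hpull : ∀ {A A' : S.C} (φ : A ⟶ A') (u : (ofBiKummerData h toB Q odd_l R ιX hopen σ K' constEmb constEmb_injective hdivc hdivp).muTorsion A' (ofBiKummerData h toB Q odd_l R ιX hopen σ K' constEmb constEmb_injective hdivc hdivp).N)
      (hu : Ψ.functor.mapAut A' (u : Aut A') ∈ (ofBiKummerData h toB Q odd_l R ιX hopen σ K' constEmb constEmb_injective hdivc hdivp).muTorsion (Ψ.functor.obj A') (ofBiKummerData h toB Q odd_l R ιX hopen σ K' constEmb constEmb_injective hdivc hdivp).N),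
      Ψ.functor.mapAut A ((ofBiKummerData h toB Q odd_l R ιX hopen σ K' constEmb constEmb_injective hdivc hdivp).muTorsionPull φ (ofBiKummerData h toB Q odd_l R ιX hopen σ K' constEmb constEmb_injective hdivc hdivp).N u : Aut A) = ((ofBiKummerData h toB Q odd_l R ιX hopen σ K' constEmb constEmb_injective hdivc hdivp).muTorsionPull (Ψ.functor.map φ) (ofBiKummerData h toB Q odd_l R ιX hopen σ K' constEmb constEmb_injective hdivc hdivp).N ⟨_, hu⟩ : Aut (Ψ.functor.obj A)))
    -- the NORMALISED Thm 5.7 transport (D_c = 1, e = 1: abc-iut-L2-d4 T1 + abc-iut-w5-d245 `capCupTransport_normalise`)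
    (α : Ψ.functor.obj (ofBiKummerData h toB Q odd_l R ιX hopen σ K' constEmb constEmb_injective hdivc hdivp).AN ≅ (ofBiKummerData h toB Q odd_l R ιX hopen σ K' constEmb constEmb_injective hdivc hdivp).AN) (β : Ψ.functor.obj (ofBiKummerData h toB Q odd_l R ιX hopen σ K' constEmb constEmb_injective hdivc hdivp).BN ≅ (ofBiKummerData h toB Q odd_l R ιX hopen σ K' constEmb constEmb_injective hdivc hdivp).BN) {Dp₀ : Aut (ofBiKummerData h toB Q odd_l R ιX hopen σ K' constEmb constEmb_injective hdivc hdivp).BN}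
    (hc₁ : α.inv ≫ Ψ.functor.map (ofBiKummerData h toB Q odd_l R ιX hopen σ K' constEmb constEmb_injective hdivc hdivp).sCap ≫ β.hom = (ofBiKummerData h toB Q odd_l R ιX hopen σ K' constEmb constEmb_injective hdivc hdivp).sCap)
    (hp₁ : α.inv ≫ Ψ.functor.map (ofBiKummerData h toB Q odd_l R ιX hopen σ K' constEmb constEmb_injective hdivc hdivp).sCup ≫ β.hom = (ofBiKummerData h toB Q odd_l R ιX hopen σ K' constEmb constEmb_injective hdivc hdivp).sCup ≫ Dp₀.hom) (hDp₀ : Dp₀ ∈ (ofBiKummerData h toB Q odd_l R ιX hopen σ K' constEmb constEmb_injective hdivc hdivp).units (ofBiKummerData h toB Q odd_l R ιX hopen σ K' constEmb constEmb_injective hdivc hdivp).BN)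
    -- [FrdI] Prop 5.6 / Thm 3.4 (iii) data at A_N (abc-iut-w5-d245's Prop 5.6 unit)
    (φ : ℕ+ →* End R.AN)
    (hφ : ∀ n : ℕ+, PreFrobenioid.degFr S.F (End.asHom (φ n)) = n ∧
      PreFrobenioid.IsBaseIdentity S.F (End.asHom (φ n)) ∧ PreFrobenioid.IsFrobeniusType S.F (End.asHom (φ n)))
    (hc : ∀ (n : ℕ+) (g : Aut R.AN.base), (σ g).hom ≫ End.asHom (φ n) = End.asHom (φ n) ≫ (σ g).hom)
    -- the base shadow θ of Ψ through α and the Frobenius transport of Ψ at A_N EXIST ([EtTh] Thm 4.4 (i), [FrdI] Thm 3.4 (iii)):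
    -- ONE binder = VERBATIM the conclusion of abc-iut-w5-d245's `exists_psiTransportData_ofBiKummerData` (p428815),
    -- discharged by that single term in the sequel `…V3Model.lean` once its module is built
    (hpsi : ∃ (θ : Aut R.AN.base ≃* Aut R.AN.base) (ΨN : ℕ+ ≃* ℕ+),
      (∀ f : Aut R.AN, (PreFrobenioid.baseFunctor S.F).mapIso (α.symm ≪≫ Ψ.functor.mapIso f ≪≫ α) =
        θ ((PreFrobenioid.baseFunctor S.F).mapIso f)) ∧
      (∀ f : R.AN ⟶ R.AN, PreFrobenioid.degFr S.F (α.inv ≫ Ψ.functor.map f ≫ α.hom) = ΨN (PreFrobenioid.degFr S.F f)) ∧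
      (∀ f : R.AN ⟶ R.AN, PreFrobenioid.IsBaseIdentity S.F f →
        PreFrobenioid.IsBaseIdentity S.F (α.inv ≫ Ψ.functor.map f ≫ α.hom)) ∧
      (∀ f : R.AN ⟶ R.AN, PreFrobenioid.IsFrobeniusType S.F f →
        PreFrobenioid.IsFrobeniusType S.F (α.inv ≫ Ψ.functor.map f ≫ α.hom)))
    -- Prop 2.4 / T56-L02 / T56-L09c for the Galois shadow of the PRODUCED base shadow of `Ψ` through `α`
    (hΓ : ∀ θA : Aut R.AN.base ≃* Aut R.AN.base,
      (∀ f : Aut R.AN, (PreFrobenioid.baseFunctor S.F).mapIso (α.symm ≪≫ Ψ.functor.mapIso f ≪≫ α) =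
        θA ((PreFrobenioid.baseFunctor S.F).mapIso f)) →
      ∃ γ : RD.PiX ≃ₜ* RD.PiX,
        (∀ y : RD.PiX, (((ofBiKummerData h toB Q odd_l R ιX hopen σ K' constEmb constEmb_injective hdivc hdivp).autBaseIsoAB.symm.trans θA).trans (ofBiKummerData h toB Q odd_l R ιX hopen σ K' constEmb constEmb_injective hdivc hdivp).autBaseIsoAB) (rhoOfBiKummerData R ιX y) =
          rhoOfBiKummerData R ιX (γ y)) ∧
        RD.PiYdd.map γ.toMulEquiv.toMonoidHom = RD.PiYdd ∧
        RD.lDeltaTheta.map γ.toMulEquiv.toMonoidHom = RD.lDeltaTheta ∧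
        ∀ (k : RD.PiYdd) (hk : (k : RD.PiX) ∈ RD.lDeltaTheta) (hk' : γ k ∈ RD.lDeltaTheta),
          (ofBiKummerData h toB Q odd_l R ιX hopen σ K' constEmb constEmb_injective hdivc hdivp).lDeltaModNMap β.hom (aΨ _ (e (RD.thetaMod ⟨k, hk⟩))) = e (RD.thetaMod ⟨γ k, hk'⟩)) :
    ∃ ρ : RigidityFamily (ofBiKummerData h toB Q odd_l R ιX hopen σ K' constEmb constEmb_injective hdivc hdivp), IsKummerDetermined (ofBiKummerData h toB Q odd_l R ιX hopen σ K' constEmb constEmb_injective hdivc hdivp) P ρ hB ∧ IsFunctorialLinear (ofBiKummerData h toB Q odd_l R ιX hopen σ K' constEmb constEmb_injective hdivc hdivp) ρ ∧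
      (∀ ρ' : RigidityFamily (ofBiKummerData h toB Q odd_l R ιX hopen σ K' constEmb constEmb_injective hdivc hdivp), IsKummerDetermined (ofBiKummerData h toB Q odd_l R ιX hopen σ K' constEmb constEmb_injective hdivc hdivp) P ρ' hB → IsFunctorialLinear (ofBiKummerData h toB Q odd_l R ιX hopen σ K' constEmb constEmb_injective hdivc hdivp) ρ' → ρ' = ρ) ∧
      CyclotomicRigidityPreserved (ofBiKummerData h toB Q odd_l R ιX hopen σ K' constEmb constEmb_injective hdivc hdivp) Ψ ρ aΨ := by
  -- hKR from the pin (abc-iut-w4-d099): the Galois-equivariance of the bi-Kummer root ⟸ Prop 5.2 (iii) read through (η₀, ν, e, m)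
  have hKR := hKR_ofBiKummerData_of_pin h toB Q odd_l R ιX hopen σ K' constEmb constEmb_injective hdivc hdivp hσ hfrac P H m hχX hη₀ hdies e ν hme hKν hcovHB
  -- the base shadow `θ` of `Ψ` through `α` and the Frobenius transport at `A_N` (existential binder `hpsi`)
  obtain ⟨θA, ΨN, hθ, hdeg, hbi, hft⟩ := hpsi
  obtain ⟨γ, hγ, hP24, hγL, haΨ⟩ := hΓ θA hθ
  exact exists_rigidityFamily_unique_preserved_ofBiKummerData_of_leaves h toB Q odd_l R ιX hopen σ K' constEmb constEmb_injective hdivc hdivp hB P hη₀ hdies e he hpre hP hcov' ν hKν hσ hgeom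
    hP34 hΔcnst hreach hLc hLi hGalT hproj hKR hH hfrac haut Ψ Ψbs eΨ aΨ hlin haΨn hpull α β hc₁ hp₁ hDp₀ φ hφ hc θA hθ ΨN hdeg
    hbi hft γ hγ hP24 hγL haΨ

end Data

end ThetaFrobenioid

end Literature.AnabelianGeometry.EtaleTheta

end
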